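import Literature.MathematicalPhysics.QuantumLattice.HartreeFockUpperBound
import Literature.MathematicalPhysics.QuantumChemistry.VariationalRDMRelaxation
import HarnessLib

/-!
# The Hartree–Fock (single-determinant) energy is an upper bound on the full-CI energy

Topic `Literature/MathematicalPhysics/QuantumChemistry`; companion of `VariationalRDMRelaxation.lean`
(the energy functional `rdmEnergy h g h_nuc γ Γ` of the FCIDUMP Hamiltonian `molecularHamiltonian`
on a pair `(¹D, ²D)`) and of `QuantumLattice/HartreeFockUpperBound.lean` (the same bound for the
Hubbard model, whose quasi-free machinery is reused verbatim). Sources: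

* V. Bach, E. H. Lieb, J. P. Solovej, *Generalized Hartree–Fock theory and the Hubbard model*,
  J. Stat. Phys. 76 (1994) 3–89 (held: arXiv:cond-mat/9312044): Thm 2.3 (a quasi-free state is
  determined by its one-particle density matrix), eq. (2c.7)
  `⟨V̂⟩ = ½ Σ V_{kl;mn} (γ_mk γ_nl − γ_ml γ_nk + α†α)` (Wick: direct minus exchange [plus pairing,
  here `α = 0`]), eq. (2c.8) (the energy of a quasi-free state is the functional `ℰ(γ)`), and
  eqs. (2c.34)–(2c.36): `E₁(γ) = Tr γh`, `E₂(γ) = ½ Σ V (γγ − γγ)`, **`E^Q ≤ E^HF ≤ E₁(γ) + E₂(γ)`**,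
  with the sentence after (2c.36): `γ_mk γ_nl − γ_ml γ_nk` IS the two-body density matrix of an
  `N`-body state when `γ` comes from a Slater determinant (`γ` an `N`-dimensional projection);
* T. Helgaker, P. Jørgensen, J. Olsen, *Molecular Electronic-Structure Theory* (Wiley 2000), §10.4.3
  "The Hartree–Fock energy" (held copy PDF p. 521), eqs. (10.4.14)–(10.4.20): `E⁽⁰⁾ = ⟨HF|Ĥ|HF⟩ =
  Σ_pq D_pq h_pq + ½ Σ_pqrs d_pqrs g_pqrs + h_nuc`, closed shell `D_ij = 2δ_ij`,
  `d_ijkl = D_ij D_kl − ½ D_il D_kj`, hence `E⁽⁰⁾ = 2 Σ_i h_ii + Σ_ij (2 g_iijj − g_ijji) + h_nuc`.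

THE RESULT. For integral tables `h, g, h_nuc` over spatial orbitals `Λ` (spin orbitals
`Orb Λ = Λ × {α, β}`) and every one-matrix `γ` on `Orb Λ` that is a Hermitian projection of rank `N`
(the one-matrix of a Slater determinant of `N` orthonormal — arbitrarily rotated — spin orbitals):

  `E₀(Ĥ; N) ≤ Re E(γ, γ∧γ)`,  `(γ∧γ)^{ij}_{kl} = γ^i_k γ^j_l − γ^i_l γ^j_k`
  (`groundEnergy_le_re_rdmEnergy_slaterTwoRDM`),

where `E(γ, Γ) = Σ h_pq Σ_σ γ_{pσ,qσ} + ½ Σ g_pqrs Σ_στ Γ_{(pσ,rτ),(qσ,sτ)} + h_nuc` is the tree's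
functional and `E₀(Ĥ; N)` the exact (`= E_fullCI`) ground-state energy of the `N`-electron sector.
The closed-shell (RHF) form `γ = ρ ⊗ 1₂` with a spatial projection `ρ` of rank `n`, `N = 2n`:
`E₀(Ĥ; 2n) ≤ Re [2 Σ_pq h_pq ρ_pq + Σ_pqrs g_pqrs (2 ρ_pq ρ_rs − ρ_ps ρ_rq) + h_nuc]`
(`groundEnergy_le_re_closedShellEnergy`), and in canonical orbitals, `ρ` = the indicator of an
occupied set `occ ⊆ Λ`: **`E₀(Ĥ; 2|occ|) ≤ Re [2 Σ_{i∈occ} h_ii + Σ_{i,j∈occ} (2 g_iijj − g_ijji) + h_nuc]`**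
(`groundEnergy_le_re_occupiedShellEnergy`) — HJO eq. (10.4.20) as an inequality against full CI.
THE `S_z`-SECTOR FORM (the one quantum chemistry uses: determinants of `a` spin-up and `b`
spin-down orbitals; Hermitian integral data): for `γ` spin-blocked (`γ_{xσ,yτ} = 0`, `σ ≠ τ`) with
block traces `(a, b)`, `E₀(Ĥ; a, b) ≤ Re E(γ, γ∧γ)` (`sectorGroundEnergy_le_re_rdmEnergy_slaterTwoRDM`,
over the tree's `sectorGroundEnergy`); closed shell `E₀(Ĥ; n, n) ≤ Re E_RHF(ρ)`
(`sectorGroundEnergy_le_re_closedShellEnergy`) and, canonically,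
**`E₀(Ĥ; |occ|, |occ|) ≤ Re [2 Σ_{i∈occ} h_ii + Σ_{i,j∈occ} (2 g_iijj − g_ijji) + h_nuc]`**
(`sectorGroundEnergy_le_re_occupiedShellEnergy`).

THE PROOF FORMALISED (BLS94 §2b–2c as in the Hubbard file; no determinant is built). The quasi-free
ground state `ω_∞` of `dΓ(1 − 2P)`, `P = γᵀ`, is a mixture of `N`-particle vector states
(`HartreeFock.groundEnergy_le_re_groundStateFunctional`: `E₀(N) ≤ Re ω_∞(H)` for ANY operator `H`)
with two-point function `ω_∞(c†_i c_j) = P_ji` (`HartreeFock.groundStateFunctional_two_point`). New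
here: the four-point function `ω_∞(c†_a c†_b c_d c_c) = P_ca P_db − P_da P_cb` by the `2 × 2` case of
the thermal determinant formula `gibbsState_dGamma_nestedWord` and the zero-temperature limit
(`gibbsState_creation_creation_annihilation_annihilation`,
`groundStateFunctional_creation_creation_annihilation_annihilation`); hence
`ω_∞(Ĥ) = E(γ, γ∧γ)` on the expansion `molecularHamiltonian_eq`
(`groundStateFunctional_molecularHamiltonian`), and the bound. For the sector form: the
spin-resolved number operators `N̂_σ = Σ_x n_{xσ}` are diagonal (`sum_numberAt_orb_eq_diagonal`),
`ω_∞(N̂_σ) = n_σ`, `ω_∞(N̂_σ²) = n_σ²` for a spin-blocked `P` (Wick pairs; the exchange sum is the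
diagonal of `P² = P` inside the block: `groundStateFunctional_sum_numberAt_orb(_sq)`), so
`(N̂_σ − n_σ) P₀ = 0` (`mul_groundProj_eq_zero_of_groundStateFunctional_sq`,
`sum_numberAt_orb_mul_groundProj`), the columns of the ground projector `P₀` lie in the sector
(`isInSector_groundProj_col`) and the tree's sector Rayleigh–Ritz principle
`sectorGroundEnergy_mul_le_re_rayleigh` gives `sectorGroundEnergy_le_re_groundStateFunctional`
(`E₀(H; a, b) ≤ Re ω_∞(H)` for every Hermitian `H`) — BLS94's Remark after Thm 2.3 ("definite
particle number iff `γ` is a projection") one spin species at a time. The definitions with a body are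
`slaterTwoRDM γ = γ∧γ` (with its antisymmetry, its contraction `Σ_j (γ∧γ)^{ij}_{kj} = (Tr γ) γ − γ²`,
`= (N − 1) γ` for a rank-`N` projection — Mazziotti's row (16)–(17) — and its trace `N(N − 1)`) and
the closed-shell one-matrix `closedShellOneRDM ρ = ρ ⊗ 1₂`.

Everything is PROVED (0 sorry); no named facts. NOT here: Lieb's variational principle for
non-idempotent `0 ≤ γ ≤ 1` (BLS94 Thm 2.12, needs repulsive `V`); the Hartree–Fock equations /
Brillouin theorem / existence and properties of minimisers; open shells other than by the general
spin-blocked theorem; DQG-feasibility of the pair `(γ, γ∧γ)`.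

## Mathlib / tree search

Tree (REUSED): `HartreeFock.hfOneBody`, `HartreeFock.groundStateFunctional_two_point`,
`HartreeFock.tendsto_gibbsState_two_point`, `HartreeFock.groundEnergy_le_re_groundStateFunctional`
(`QuantumLattice/HartreeFockUpperBound.lean`); `gibbsState_dGamma_nestedWord`, `nestedWord`, `wordOp`,
`letterOp` (`FermionQuasiFreeWick`, `FermionTraceFactorization`); `Matrix.groundStateFunctional`,
`Matrix.groundStateFunctional_one`, `tendsto_gibbsState_atTop_holds` (`FinDimSpectrum*`);
`molecularHamiltonian_eq` (`SecondQuantizedHamiltonian`), `rdmEnergy` (`VariationalRDMRelaxation`).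
`lean search 'HartreeFock|hfEnergy|slater'`: Hartree–Fock bounds exist in the tree only for Hubbard
Hamiltonians (`HartreeFockUpperBound`, `HartreeFockGramProjector`, …); nothing for the FCIDUMP
Hamiltonian; Mathlib has none.

## References

* V. Bach, E. H. Lieb, J. P. Solovej, J. Stat. Phys. 76 (1994) 3–89, arXiv:cond-mat/9312044, Thm 2.3,
  eqs. (2c.7)–(2c.8), (2c.34)–(2c.36). [BachLiebSolovej1994]
* T. Helgaker, P. Jørgensen, J. Olsen, *Molecular Electronic-Structure Theory*, Wiley (2000), §10.4.3
  eqs. (10.4.14)–(10.4.20); §4.2.1 (the variation principle). [HelgakerJorgensenOlsen2000]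
* E. H. Lieb, *Variational principle for many-fermion systems*, Phys. Rev. Lett. 46 (1981) 457–459
  (named as origin of the `0 ≤ γ ≤ 1` form only; not used).
-/

noncomputable section

namespace Literature.MathematicalPhysics.QuantumChemistry

open Matrix Finset Filter Topology Literature.MathematicalPhysics.QuantumLattice
  Literature.MathematicalPhysics.QuantumLattice.HartreeFock
open scoped ComplexOrder

/-! ### Wick's theorem for `c†_a c†_b c_d c_c` in a gauge-invariant quasi-free state -/

section Wick

variable {ι : Type*} [LinearOrder ι] [Fintype ι]

/-- The nested word `c†_a c†_b c_d c_c` as an operator. [folklore] -/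
private theorem wordOp_nestedWord_creation_creation (a b c d : ι) :
    wordOp (nestedWord 2 ![a, b] ![c, d]) =
      creation a * creation b * annihilation d * annihilation c := by
  have r0 : Fin.rev (0 : Fin 2) = 1 := by decide
  have r1 : Fin.rev (1 : Fin 2) = 0 := by decide
  simp [nestedWord, wordOp_cons, letterOp, List.ofFn_succ, r0, r1, Matrix.mul_assoc]

/-- **Wick's theorem for a normal-ordered quartic monomial** in the quasi-free Gibbs state of
`dΓ(h)` (`h` Hermitian, `β` real):
`⟨c†_a c†_b c_d c_c⟩_β = ⟨c†_a c_c⟩⟨c†_b c_d⟩ − ⟨c†_a c_d⟩⟨c†_b c_c⟩` (direct minus exchange; the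
`c†c†` contraction vanishes) — the `2 × 2` case of the determinant formula
`gibbsState_dGamma_nestedWord`. BLS94 eq. (2c.7) with `α = 0`; Gaudin (1960).
[cite: BachLiebSolovej1994, eq. (2c.7)] -/
theorem gibbsState_creation_creation_annihilation_annihilation {h : Matrix ι ι ℂ}
    (hh : h.IsHermitian) (β : ℝ) (a b c d : ι) :
    gibbsState β (dGamma h) (creation a * creation b * annihilation d * annihilation c) =
      gibbsState β (dGamma h) (creation a * annihilation c) *
          gibbsState β (dGamma h) (creation b * annihilation d) -
        gibbsState β (dGamma h) (creation a * annihilation d) *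
          gibbsState β (dGamma h) (creation b * annihilation c) := by
  rw [← wordOp_nestedWord_creation_creation, gibbsState_dGamma_nestedWord hh β 2,
    Matrix.det_fin_two]
  simp

/-- **Zero-temperature four-point function of the Hartree–Fock reference state**: in the
ground-state functional `ω_∞` of `dΓ(1 − 2P)` (`P` a Hermitian projection),
`ω_∞(c†_a c†_b c_d c_c) = P_ca P_db − P_da P_cb` (two-point function `ω_∞(c†_i c_j) = P_ji`,
BLS94 Thm 2.3; Wick (2c.7) with `α = 0`; zero-temperature limit of the Gibbs states).
[cite: BachLiebSolovej1994, Thm 2.3; eq. (2c.7)] -/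
theorem groundStateFunctional_creation_creation_annihilation_annihilation {P : Matrix ι ι ℂ}
    (hP : P.IsHermitian) (hPP : P * P = P) (a b c d : ι) :
    (dGamma (hfOneBody P)).groundStateFunctional
        (creation a * creation b * annihilation d * annihilation c) =
      P c a * P d b - P d a * P c b := by
  haveI : Nonempty (Finset ι) := ⟨∅⟩
  have hK := isHermitian_dGamma (isHermitian_hfOneBody hP)
  refine tendsto_nhds_unique (tendsto_gibbsState_atTop_holds hK _) ?_
  have hlim := ((tendsto_gibbsState_two_point hP hPP a c).mul
    (tendsto_gibbsState_two_point hP hPP b d)).sub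
    ((tendsto_gibbsState_two_point hP hPP a d).mul (tendsto_gibbsState_two_point hP hPP b c))
  refine hlim.congr' (Eventually.of_forall fun β => ?_)
  exact (gibbsState_creation_creation_annihilation_annihilation (isHermitian_hfOneBody hP)
    β a b c d).symm

end Wick

/-! ### The two-matrix `γ ∧ γ` of a single determinant -/

section Slater

variable {ι : Type*} [Fintype ι] [DecidableEq ι]

omit [Fintype ι] [DecidableEq ι] in
/-- **The two-matrix of a single-determinant (gauge-invariant quasi-free) state with one-matrix
`γ`** in the tree's unit normalisation `²D^{ij}_{kl} = ⟨a†_i a†_j a_l a_k⟩`: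
`(γ∧γ)^{ij}_{kl} = γ^i_k γ^j_l − γ^i_l γ^j_k` (direct minus exchange). BLS94 eq. (2c.7) (`α = 0`) and
the sentence after (2c.36) ("the two-body reduced density matrix … when `γ` comes from a Slater
determinant"); closed-shell spin-summed form HJO eq. (10.4.19) `d_ijkl = D_ij D_kl − ½ D_il D_kj`.
[cite: BachLiebSolovej1994, eq. (2c.7)] -/
def slaterTwoRDM (γ : Matrix ι ι ℂ) : Matrix (ι × ι) (ι × ι) ℂ :=
  fun p q => γ p.1 q.1 * γ p.2 q.2 - γ p.1 q.2 * γ p.2 q.1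

omit [Fintype ι] [DecidableEq ι] in
/-- Entries of `γ ∧ γ`. [cite: BachLiebSolovej1994, eq. (2c.7)] -/
theorem slaterTwoRDM_apply (γ : Matrix ι ι ℂ) (i j k l : ι) :
    slaterTwoRDM γ (i, j) (k, l) = γ i k * γ j l - γ i l * γ j k := rfl

omit [Fintype ι] [DecidableEq ι] in
/-- `γ ∧ γ` is antisymmetric in the upper index pair (a fermionic two-matrix, Mazziotti (2007)
eq. (9)). [cite: Mazziotti2007RDMChapter, §II.B eq. (9)] -/
theorem slaterTwoRDM_swap_fst (γ : Matrix ι ι ℂ) (i j : ι) (q : ι × ι) :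
    slaterTwoRDM γ (j, i) q = -slaterTwoRDM γ (i, j) q := by
  simp only [slaterTwoRDM]
  ring

omit [Fintype ι] [DecidableEq ι] in
/-- `γ ∧ γ` is antisymmetric in the lower index pair. [cite: Mazziotti2007RDMChapter, §II.B eq. (9)] -/
theorem slaterTwoRDM_swap_snd (γ : Matrix ι ι ℂ) (p : ι × ι) (k l : ι) :
    slaterTwoRDM γ p (l, k) = -slaterTwoRDM γ p (k, l) := by
  simp only [slaterTwoRDM]
  ring

omit [DecidableEq ι] in
/-- **Contraction of `γ ∧ γ`**: `Σ_j (γ∧γ)^{ij}_{kj} = (Tr γ) γ^i_k − (γ²)^i_k`.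
[cite: BachLiebSolovej1994, eq. (2c.7)] -/
theorem sum_slaterTwoRDM_snd (γ : Matrix ι ι ℂ) (i k : ι) :
    ∑ j, slaterTwoRDM γ (i, j) (k, j) = γ.trace * γ i k - (γ * γ) i k := by
  simp only [slaterTwoRDM, Finset.sum_sub_distrib, Matrix.trace, Matrix.diag_apply,
    Matrix.mul_apply, Finset.sum_mul]
  congr 1
  exact Finset.sum_congr rfl fun j _ => mul_comm _ _

omit [DecidableEq ι] in
/-- For a rank-`N` projection `γ` (`γ² = γ`, `Tr γ = N`) the pair `(γ, γ∧γ)` satisfies Mazziotti's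
contraction row `Σ_j ²D^{ij}_{kj} = (N − 1) ¹D^i_k` (2007, eqs. (16)–(17)).
[cite: Mazziotti2007RDMChapter, §II.B eqs. (16)-(17)] -/
theorem sum_slaterTwoRDM_snd_of_mul_self {γ : Matrix ι ι ℂ} (hγγ : γ * γ = γ) {N : ℂ}
    (htr : γ.trace = N) (i k : ι) :
    ∑ j, slaterTwoRDM γ (i, j) (k, j) = (N - 1) * γ i k := by
  rw [sum_slaterTwoRDM_snd, hγγ, htr]
  ring

omit [DecidableEq ι] in
/-- **Trace of `γ ∧ γ`**: `Σ_{ij} (γ∧γ)^{ij}_{ij} = (Tr γ)² − Tr(γ²)`.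
[cite: BachLiebSolovej1994, eq. (2c.7)] -/
theorem sum_slaterTwoRDM_diag (γ : Matrix ι ι ℂ) :
    ∑ p : ι × ι, slaterTwoRDM γ p p = γ.trace ^ 2 - (γ * γ).trace := by
  rw [Fintype.sum_prod_type]
  simp only [slaterTwoRDM, Finset.sum_sub_distrib, Matrix.trace, Matrix.diag_apply,
    Matrix.mul_apply, sq, Finset.sum_mul_sum]

omit [DecidableEq ι] in
/-- For a rank-`N` projection the trace row `Σ_{ij} ²D^{ij}_{ij} = N(N − 1)` (Mazziotti (2007)
eq. (16)) holds for `(γ, γ∧γ)`. [cite: Mazziotti2007RDMChapter, §II.B eq. (16)] -/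
theorem sum_slaterTwoRDM_diag_of_mul_self {γ : Matrix ι ι ℂ} (hγγ : γ * γ = γ) {N : ℂ}
    (htr : γ.trace = N) :
    ∑ p : ι × ι, slaterTwoRDM γ p p = N * (N - 1) := by
  rw [sum_slaterTwoRDM_diag, hγγ, htr]
  ring

end Slater

/-! ### The molecular Hamiltonian in the Hartree–Fock reference state and the bound -/

section Molecular

variable {Λ : Type*} [LinearOrder Λ] [Fintype Λ]

/-- **The energy of the single-determinant state is the functional at `(γ, γ∧γ)`**: for a
Hermitian projection `P` on the spin-orbital space, the quasi-free ground state `ω_∞` of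
`dΓ(1 − 2P)` has `ω_∞(Ĥ(h, g, h_nuc)) = E(γ, γ∧γ)` with `γ = Pᵀ` (its one-matrix in the tree's
convention `¹D^i_k = ⟨a†_i a_k⟩`). BLS94 eq. (2c.8) (`ρ(H) = ℰ(γ)`: `Tr[hγ]` plus direct minus
exchange); HJO eqs. (10.4.14)–(10.4.17). [cite: BachLiebSolovej1994, eq. (2c.8)] -/
theorem groundStateFunctional_molecularHamiltonian {P : Matrix (Orb Λ) (Orb Λ) ℂ}
    (hP : P.IsHermitian) (hPP : P * P = P) (h : Λ → Λ → ℂ) (g : Λ → Λ → Λ → Λ → ℂ) (hnuc : ℂ) :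
    (dGamma (hfOneBody P)).groundStateFunctional (molecularHamiltonian h g hnuc) =
      rdmEnergy h g hnuc Pᵀ (slaterTwoRDM Pᵀ) := by
  haveI : Nonempty (Finset (Orb Λ)) := ⟨∅⟩
  have hK := isHermitian_dGamma (isHermitian_hfOneBody hP)
  set ω := (dGamma (hfOneBody P)).groundStateFunctional with hω
  have h1 : ∀ (p q : Λ) (σ : Fin 2),
      ω (creation (orb p σ) * annihilation (orb q σ)) = Pᵀ (orb p σ) (orb q σ) := by
    intro p q σ
    rw [Matrix.transpose_apply]
    exact groundStateFunctional_two_point hP hPP _ _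
  have h2 : ∀ (p q r s : Λ) (σ τ : Fin 2),
      ω (creation (orb p σ) * creation (orb r τ) * annihilation (orb s τ) * annihilation (orb q σ)) =
        slaterTwoRDM Pᵀ (orb p σ, orb r τ) (orb q σ, orb s τ) := by
    intro p q r s σ τ
    rw [slaterTwoRDM_apply, Matrix.transpose_apply, Matrix.transpose_apply, Matrix.transpose_apply,
      Matrix.transpose_apply]
    exact groundStateFunctional_creation_creation_annihilation_annihilation hP hPP _ _ _ _
  rw [molecularHamiltonian_eq, rdmEnergy, map_add, map_add, map_smul, map_smul, smul_eq_mul,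
    smul_eq_mul, groundStateFunctional_one hK, mul_one]
  simp only [map_sum, map_smul, smul_eq_mul, h1, h2]

/-- **THE HARTREE–FOCK ENERGY IS AN UPPER BOUND ON THE FULL-CI ENERGY.** For every Hermitian
projection `γ` of rank `N` on the spin-orbital space `Orb Λ` (the one-matrix of a Slater determinant
of `N` orthonormal, arbitrarily rotated spin orbitals) and every integral table,
`E₀(Ĥ(h, g, h_nuc); N) ≤ Re E(γ, γ∧γ)` — the single-determinant energy
`Σ h_pq Σ_σ γ_{pσ,qσ} + ½ Σ g_pqrs Σ_στ (γ_{pσ,qσ} γ_{rτ,sτ} − γ_{pσ,sτ} γ_{rτ,qσ}) + h_nuc`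
lies above the exact ground-state energy of the `N`-electron sector. BLS94 eqs. (2c.34)–(2c.36)
(`E^Q ≤ E₁(γ) + E₂(γ)`, `γ` an `N`-dimensional projection); HJO (10.4.14) with the variation
principle §4.2.1. [cite: BachLiebSolovej1994, eq. (2c.36)] -/
theorem groundEnergy_le_re_rdmEnergy_slaterTwoRDM (h : Λ → Λ → ℂ) (g : Λ → Λ → Λ → Λ → ℂ)
    (hnuc : ℂ) {γ : Matrix (Orb Λ) (Orb Λ) ℂ} (hγ : γ.IsHermitian) (hγγ : γ * γ = γ) {N : ℕ}
    (htr : γ.trace = N) :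
    Literature.MathematicalPhysics.QuantumLattice.groundEnergy (molecularHamiltonian h g hnuc) N ≤
      (rdmEnergy h g hnuc γ (slaterTwoRDM γ)).re := by
  have hP : γᵀ.IsHermitian := hγ.transpose
  have hPP : γᵀ * γᵀ = γᵀ := by rw [← Matrix.transpose_mul, hγγ]
  have hPtr : γᵀ.trace = N := by rw [Matrix.trace_transpose, htr]
  have hmain := groundEnergy_le_re_groundStateFunctional hP hPP hPtr (molecularHamiltonian h g hnuc)
  rwa [groundStateFunctional_molecularHamiltonian hP hPP, Matrix.transpose_transpose] at hmain

omit [LinearOrder Λ] in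
/-- The single-determinant energy written out: `E(γ, γ∧γ) = Σ_pq h_pq Σ_σ γ_{pσ,qσ} +
½ Σ_pqrs g_pqrs Σ_στ (γ_{pσ,qσ} γ_{rτ,sτ} − γ_{pσ,sτ} γ_{rτ,qσ}) + h_nuc` (spin-orbital form of
HJO (10.4.15) with the determinant densities (10.4.16)–(10.4.17); BLS94 (2c.34)–(2c.35)).
[cite: HelgakerJorgensenOlsen2000, eq. (10.4.15)] -/
theorem rdmEnergy_slaterTwoRDM (h : Λ → Λ → ℂ) (g : Λ → Λ → Λ → Λ → ℂ) (hnuc : ℂ)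
    (γ : Matrix (Orb Λ) (Orb Λ) ℂ) :
    rdmEnergy h g hnuc γ (slaterTwoRDM γ) =
      ∑ p : Λ, ∑ q : Λ, h p q * ∑ σ : Fin 2, γ (orb p σ) (orb q σ) +
        (1 / 2 : ℂ) * ∑ p : Λ, ∑ q : Λ, ∑ r : Λ, ∑ s : Λ, g p q r s * ∑ σ : Fin 2, ∑ τ : Fin 2,
          (γ (orb p σ) (orb q σ) * γ (orb r τ) (orb s τ) -
            γ (orb p σ) (orb s τ) * γ (orb r τ) (orb q σ)) +
        hnuc := rfl

omit [LinearOrder Λ] in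
/-- Sums over spin orbitals as iterated sums. [folklore] -/
private theorem sum_orb_eq_sum_sum_spin {M : Type*} [AddCommMonoid M] (F : Orb Λ → M) :
    ∑ o, F o = ∑ x : Λ, ∑ σ : Fin 2, F (orb x σ) := by
  rw [← Fintype.sum_prod_type', ← (toLex : Λ × Fin 2 ≃ Orb Λ).sum_comp]

/-! ### `S_z` sectors: a spin-blocked one-matrix gives a bound on the sector energy -/

/-- The spin-resolved number operator is diagonal: `Σ_x n_{xσ} |s⟩ = #{x : xσ ∈ s} |s⟩`.
Tasaki (2020) §9.2 (`n_i` diagonal in the occupation basis). [cite: Tasaki2020, §9.2] -/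
theorem sum_numberAt_orb_eq_diagonal (σ : Fin 2) :
    ∑ x : Λ, numberAt (orb x σ) =
      Matrix.diagonal fun s : Finset (Orb Λ) => (((univ.filter fun x : Λ => orb x σ ∈ s).card : ℕ) : ℂ) := by
  ext s t
  simp only [Matrix.sum_apply, numberAt_eq_diagonal, Matrix.diagonal_apply]
  split_ifs with hst
  · subst hst
    rw [Finset.sum_boole]
  · simp

/-- For a Hermitian operator `M` with `ω_∞(M²) = 0` in the ground-state functional of a Hermitian
`K`, `M` annihilates the ground projector: `M P₀ = 0` (`tr(P₀ M²) = ‖M P₀‖²`). BLS94 Remark after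
Thm 2.3 (vanishing number fluctuations pin the particle number); the step isolated from
`HartreeFock.totalNumberOp_mul_groundProj`. [cite: BachLiebSolovej1994, Thm 2.3] -/
theorem mul_groundProj_eq_zero_of_groundStateFunctional_sq {n : Type*} [Fintype n] [DecidableEq n]
    [Nonempty n] {K M : Matrix n n ℂ} (hK : K.IsHermitian) (hM : Mᴴ = M)
    (h0 : K.groundStateFunctional (M * M) = 0) : M * K.groundProj = 0 := by
  set P₀ := K.groundProj with hP₀
  have hP₀sq : P₀ * P₀ = P₀ := by rw [hP₀]; exact groundProj_mul_self K
  have hP₀h : P₀ᴴ = P₀ := by rw [hP₀]; exact (groundProj_isHermitian K).eq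
  have htr : (P₀ * (M * M)).trace = 0 := by
    rw [groundStateFunctional_apply, mul_eq_zero] at h0
    rcases h0 with h | h
    · exact absurd (inv_eq_zero.mp h) (trace_groundProj_ne_zero hK)
    · exact h
  have hA : (M * P₀)ᴴ * (M * P₀) = 0 := by
    refine (posSemidef_conjTranspose_mul_self (M * P₀)).trace_eq_zero_iff.mp ?_
    calc ((M * P₀)ᴴ * (M * P₀)).trace = (P₀ * (M * (M * P₀))).trace := by
          rw [conjTranspose_mul, hP₀h, hM, Matrix.mul_assoc]
      _ = ((M * (M * P₀)) * P₀).trace := trace_mul_comm _ _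
      _ = (M * (M * P₀)).trace := by rw [Matrix.mul_assoc, Matrix.mul_assoc, hP₀sq]
      _ = (P₀ * (M * M)).trace := by rw [← Matrix.mul_assoc, trace_mul_comm]
      _ = 0 := htr
  exact Matrix.conjTranspose_mul_self_eq_zero.mp hA

omit [LinearOrder Λ] in
/-- For a spin-blocked projection `P` (`P_{xσ,yτ} = 0` for `σ ≠ τ`, `P² = P`):
`Σ_y P_{xσ,yσ} P_{yσ,xσ} = P_{xσ,xσ}` (the diagonal of `P² = P` inside one spin block). [folklore] -/
private theorem sum_block_mul_block_eq {P : Matrix (Orb Λ) (Orb Λ) ℂ} (hPP : P * P = P)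
    (hblock : ∀ (x y : Λ) (σ τ : Fin 2), σ ≠ τ → P (orb x σ) (orb y τ) = 0) (x : Λ) (σ : Fin 2) :
    ∑ y : Λ, P (orb x σ) (orb y σ) * P (orb y σ) (orb x σ) = P (orb x σ) (orb x σ) := by
  have h := congrFun (congrFun hPP (orb x σ)) (orb x σ)
  rw [Matrix.mul_apply, sum_orb_eq_sum_sum_spin] at h
  rw [← h]
  refine Finset.sum_congr rfl fun y _ => ?_
  rw [Fintype.sum_eq_single σ fun τ hτ => by rw [hblock x y σ τ (Ne.symm hτ), zero_mul]]

/-- `ω_∞(N̂_σ) = Σ_x P_{xσ,xσ}` for the quasi-free ground state of `dΓ(1 − 2P)`.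
[cite: BachLiebSolovej1994, Thm 2.3] -/
theorem groundStateFunctional_sum_numberAt_orb {P : Matrix (Orb Λ) (Orb Λ) ℂ}
    (hP : P.IsHermitian) (hPP : P * P = P) (σ : Fin 2) :
    (dGamma (hfOneBody P)).groundStateFunctional (∑ x : Λ, numberAt (orb x σ)) =
      ∑ x : Λ, P (orb x σ) (orb x σ) := by
  rw [map_sum]
  exact Finset.sum_congr rfl fun x _ => groundStateFunctional_numberAt hP hPP _

/-- **No spin-resolved number fluctuations for a spin-blocked projection**:
`ω_∞(N̂_σ²) = (Σ_x P_{xσ,xσ})²` (Wick pairs `ω_∞(n_a n_b) = P_aa P_bb − P_ba P_ab`, and the exchange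
sum is the diagonal of `P² = P` within the block). BLS94 Remark after Thm 2.3 / Lemma 2.7 with
`α = 0`. [cite: BachLiebSolovej1994, Lemma 2.7] -/
theorem groundStateFunctional_sum_numberAt_orb_sq {P : Matrix (Orb Λ) (Orb Λ) ℂ}
    (hP : P.IsHermitian) (hPP : P * P = P)
    (hblock : ∀ (x y : Λ) (σ τ : Fin 2), σ ≠ τ → P (orb x σ) (orb y τ) = 0) (σ : Fin 2) :
    (dGamma (hfOneBody P)).groundStateFunctional
        ((∑ x : Λ, numberAt (orb x σ)) * ∑ x : Λ, numberAt (orb x σ)) =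
      (∑ x : Λ, P (orb x σ) (orb x σ)) ^ 2 := by
  set ω := (dGamma (hfOneBody P)).groundStateFunctional with hω
  set nσ : ℂ := ∑ x : Λ, P (orb x σ) (orb x σ) with hnσ
  have hpair : ∀ x y : Λ, ω (numberAt (orb x σ) * numberAt (orb y σ)) =
      P (orb x σ) (orb x σ) * P (orb y σ) (orb y σ) -
          P (orb x σ) (orb y σ) * P (orb y σ) (orb x σ) +
        (if x = y then P (orb x σ) (orb x σ) else 0) := by
    intro x y
    by_cases hxy : x = y
    · subst hxy
      rw [if_pos rfl, (numberAt_idempotent _).eq, groundStateFunctional_numberAt hP hPP]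
      ring
    · have hne : orb x σ ≠ orb y σ := fun h => hxy (orb_inj.1 h).1
      rw [if_neg hxy, add_zero, groundStateFunctional_numberAt_mul_numberAt hP hPP hne]
      ring
  have hrow : ∀ x : Λ, ∑ y : Λ, ω (numberAt (orb x σ) * numberAt (orb y σ)) =
      P (orb x σ) (orb x σ) * nσ := by
    intro x
    rw [Finset.sum_congr rfl fun y _ => hpair x y, Finset.sum_add_distrib, Finset.sum_sub_distrib,
      Finset.sum_ite_eq, ← Finset.mul_sum, sum_block_mul_block_eq hPP hblock x σ, if_pos (mem_univ x)]
    ring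
  rw [Finset.sum_mul_sum, map_sum]
  simp_rw [map_sum]
  rw [Finset.sum_congr rfl fun x _ => hrow x, ← Finset.sum_mul, sq]

/-- **The quasi-free ground state of a spin-blocked projection lives in ONE `S_z` sector**:
`N̂_σ P₀ = n_σ P₀` with `n_σ = Σ_x P_{xσ,xσ}` (from `ω_∞((N̂_σ − n_σ)²) = 0`). BLS94 Remark after
Thm 2.3. [cite: BachLiebSolovej1994, Thm 2.3] -/
theorem sum_numberAt_orb_mul_groundProj {P : Matrix (Orb Λ) (Orb Λ) ℂ} (hP : P.IsHermitian)
    (hPP : P * P = P) (hblock : ∀ (x y : Λ) (σ τ : Fin 2), σ ≠ τ → P (orb x σ) (orb y τ) = 0)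
    (σ : Fin 2) {c : ℂ} (hc : ∑ x : Λ, P (orb x σ) (orb x σ) = c) :
    (∑ x : Λ, numberAt (orb x σ)) * (dGamma (hfOneBody P)).groundProj =
      c • (dGamma (hfOneBody P)).groundProj := by
  haveI : Nonempty (Finset (Orb Λ)) := ⟨∅⟩
  have hK := isHermitian_dGamma (isHermitian_hfOneBody hP)
  set Nσ : Matrix (Finset (Orb Λ)) (Finset (Orb Λ)) ℂ := ∑ x : Λ, numberAt (orb x σ) with hNσ
  set M : Matrix (Finset (Orb Λ)) (Finset (Orb Λ)) ℂ := Nσ - c • 1 with hM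
  have hcreal : star c = c := by
    rw [← hc, star_sum]
    exact Finset.sum_congr rfl fun x _ => hP.apply _ _
  have hNh : Nσᴴ = Nσ := by
    rw [hNσ, sum_numberAt_orb_eq_diagonal, Matrix.diagonal_conjTranspose]
    congr 1
    funext s
    simp
  have hMh : Mᴴ = M := by
    rw [hM, conjTranspose_sub, conjTranspose_smul, conjTranspose_one, hNh, hcreal]
  have hfluct : (dGamma (hfOneBody P)).groundStateFunctional (M * M) = 0 := by
    have hexp : M * M = Nσ * Nσ - c • Nσ - c • Nσ + (c * c) • (1 : Matrix _ _ ℂ) := by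
      simp only [hM, sub_mul, mul_sub, mul_smul_comm, smul_mul_assoc, mul_one, one_mul, smul_sub,
        smul_smul]
      abel
    rw [hexp, map_add, map_sub, map_sub, map_smul, map_smul, hNσ,
      groundStateFunctional_sum_numberAt_orb_sq hP hPP hblock σ,
      groundStateFunctional_sum_numberAt_orb hP hPP σ, groundStateFunctional_one hK, hc, smul_eq_mul,
      smul_eq_mul]
    ring
  have hMP := mul_groundProj_eq_zero_of_groundStateFunctional_sq hK hMh hfluct
  rw [hM, sub_mul, sub_eq_zero, smul_mul_assoc, one_mul] at hMP
  exact hMP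

/-- Every column of the ground projector of `dΓ(1 − 2P)`, `P` a spin-blocked projection with
block traces `(a, b)`, lies in the sector `N↑ = a`, `N↓ = b`. BLS94 Remark after Thm 2.3.
[cite: BachLiebSolovej1994, Thm 2.3] -/
theorem isInSector_groundProj_col {P : Matrix (Orb Λ) (Orb Λ) ℂ} (hP : P.IsHermitian)
    (hPP : P * P = P) (hblock : ∀ (x y : Λ) (σ τ : Fin 2), σ ≠ τ → P (orb x σ) (orb y τ) = 0)
    {a b : ℕ} (ha : ∑ x : Λ, P (orb x 0) (orb x 0) = a) (hb : ∑ x : Λ, P (orb x 1) (orb x 1) = b)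
    (s : Finset (Orb Λ)) :
    IsInSector a b (fun r => (dGamma (hfOneBody P)).groundProj r s) := by
  intro r hr
  have key : ∀ (σ : Fin 2) (c : ℕ),
      (∑ x : Λ, numberAt (orb x σ)) * (dGamma (hfOneBody P)).groundProj =
        (c : ℂ) • (dGamma (hfOneBody P)).groundProj →
      (univ.filter fun x : Λ => orb x σ ∈ r).card ≠ c →
        (dGamma (hfOneBody P)).groundProj r s = 0 := by
    intro σ c h hne
    have h' := congrFun (congrFun h r) s
    rw [sum_numberAt_orb_eq_diagonal, diagonal_mul, Matrix.smul_apply, smul_eq_mul] at h'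
    have h'' : (((univ.filter fun x : Λ => orb x σ ∈ r).card : ℕ) - (c : ℂ)) *
        (dGamma (hfOneBody P)).groundProj r s = 0 := by
      rw [sub_mul, h', sub_self]
    rcases mul_eq_zero.mp h'' with h₁ | h₁
    · exact absurd (by exact_mod_cast (sub_eq_zero.mp h₁)) hne
    · exact h₁
  by_cases hu : (upPart r).card = a
  · have hd : (downPart r).card ≠ b := fun h => hr ⟨hu, h⟩
    exact key 1 b (sum_numberAt_orb_mul_groundProj hP hPP hblock 1 hb) hd
  · exact key 0 a (sum_numberAt_orb_mul_groundProj hP hPP hblock 0 ha) hu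

/-- **Sector variational principle for the quasi-free ground state**: for a spin-blocked
Hermitian projection `P` with block traces `(a, b)` and ANY Hermitian operator `H` on Fock space,
`E₀(H; a, b) ≤ Re ω_∞(H)` (`ω_∞ = tr(P₀ ·)/tr P₀` is a mixture of vector states of the `(a, b)`
sector). BLS94 (2c.36) read in a fixed `S_z` sector; Tasaki (2020) §2.2 (min–max in an invariant
subspace). [cite: BachLiebSolovej1994, eq. (2c.36)] -/
theorem sectorGroundEnergy_le_re_groundStateFunctional {P : Matrix (Orb Λ) (Orb Λ) ℂ}
    (hP : P.IsHermitian) (hPP : P * P = P)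
    (hblock : ∀ (x y : Λ) (σ τ : Fin 2), σ ≠ τ → P (orb x σ) (orb y τ) = 0) {a b : ℕ}
    (ha : ∑ x : Λ, P (orb x 0) (orb x 0) = a) (hb : ∑ x : Λ, P (orb x 1) (orb x 1) = b)
    {H : Matrix (Finset (Orb Λ)) (Finset (Orb Λ)) ℂ} (hH : H.IsHermitian) :
    sectorGroundEnergy H a b ≤ ((dGamma (hfOneBody P)).groundStateFunctional H).re := by
  haveI : Nonempty (Finset (Orb Λ)) := ⟨∅⟩
  set K := dGamma (hfOneBody P) with hKdef
  have hK : K.IsHermitian := isHermitian_dGamma (isHermitian_hfOneBody hP)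
  set P₀ := K.groundProj with hP₀
  have hP₀sq : P₀ * P₀ = P₀ := by rw [hP₀]; exact groundProj_mul_self K
  have hP₀h : P₀.IsHermitian := by rw [hP₀]; exact groundProj_isHermitian K
  set col : Finset (Orb Λ) → Fock (Orb Λ) := fun s r => P₀ r s with hcol
  have hstar : ∀ r s, star (P₀ r s) = P₀ s r := fun r s => hP₀h.apply s r
  have hexp : ∀ s, star (col s) ⬝ᵥ H *ᵥ col s = (P₀ * (H * P₀)) s s := by
    intro s
    simp only [dotProduct, mulVec, Matrix.mul_apply, hcol, Pi.star_apply, hstar, Finset.mul_sum]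
  have htrH : (P₀ * H).trace = ∑ s, star (col s) ⬝ᵥ H *ᵥ col s := by
    have h1 : (P₀ * (H * P₀)).trace = (P₀ * H).trace := by
      rw [trace_mul_comm, Matrix.mul_assoc, hP₀sq, trace_mul_comm]
    rw [← h1, Matrix.trace]
    exact Finset.sum_congr rfl fun s _ => (hexp s).symm
  have hnorm : ∑ s, star (col s) ⬝ᵥ col s = P₀.trace := by
    conv_rhs => rw [← hP₀sq]
    rw [Matrix.trace]
    refine Finset.sum_congr rfl fun s _ => ?_
    simp only [Matrix.diag_apply, Matrix.mul_apply, dotProduct, hcol, Pi.star_apply, hstar]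
  have hpos : 0 < P₀.trace := by rw [hP₀]; exact trace_groundProj_pos hK
  obtain ⟨hre, him⟩ := Complex.lt_def.mp hpos
  rw [Complex.zero_re] at hre
  rw [Complex.zero_im] at him
  have htrre : P₀.trace = ((P₀.trace.re : ℝ) : ℂ) := by
    apply Complex.ext <;> simp [← him]
  have hmain : sectorGroundEnergy H a b * P₀.trace.re ≤ ((P₀ * H).trace).re := by
    rw [htrH, Complex.re_sum, ← hnorm, Complex.re_sum, Finset.mul_sum]
    exact Finset.sum_le_sum fun s _ =>
      sectorGroundEnergy_mul_le_re_rayleigh hH (isInSector_groundProj_col hP hPP hblock ha hb s)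
  rw [groundStateFunctional_apply]
  change sectorGroundEnergy H a b ≤ ((P₀.trace)⁻¹ * (P₀ * H).trace).re
  rw [htrre, ← Complex.ofReal_inv, Complex.re_ofReal_mul, le_inv_mul_iff₀ hre, mul_comm]
  exact hmain

/-- **THE HARTREE–FOCK ENERGY OF A SPIN-BLOCKED DETERMINANT BOUNDS THE SECTOR ENERGY** (UHF/RHF
form used in quantum chemistry, where determinants are built from `a` spin-up and `b` spin-down
orbitals): for Hermitian integral data and every Hermitian projection `γ` on `Orb Λ` with
`γ_{xσ,yτ} = 0` for `σ ≠ τ` and block traces `Σ_x γ_{x↑,x↑} = a`, `Σ_x γ_{x↓,x↓} = b`,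
`E₀(Ĥ; a, b) ≤ Re E(γ, γ∧γ)`. BLS94 eqs. (2c.34)–(2c.36) within the `(N↑, N↓) = (a, b)` sector;
HJO §10.4.3. [cite: BachLiebSolovej1994, eq. (2c.36)] -/
theorem sectorGroundEnergy_le_re_rdmEnergy_slaterTwoRDM {h : Λ → Λ → ℂ} {g : Λ → Λ → Λ → Λ → ℂ}
    {hnuc : ℂ} (hH : (molecularHamiltonian h g hnuc).IsHermitian) {γ : Matrix (Orb Λ) (Orb Λ) ℂ}
    (hγ : γ.IsHermitian) (hγγ : γ * γ = γ)
    (hblock : ∀ (x y : Λ) (σ τ : Fin 2), σ ≠ τ → γ (orb x σ) (orb y τ) = 0) {a b : ℕ}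
    (ha : ∑ x : Λ, γ (orb x 0) (orb x 0) = a) (hb : ∑ x : Λ, γ (orb x 1) (orb x 1) = b) :
    sectorGroundEnergy (molecularHamiltonian h g hnuc) a b ≤
      (rdmEnergy h g hnuc γ (slaterTwoRDM γ)).re := by
  have hP : γᵀ.IsHermitian := hγ.transpose
  have hPP : γᵀ * γᵀ = γᵀ := by rw [← Matrix.transpose_mul, hγγ]
  have hPblock : ∀ (x y : Λ) (σ τ : Fin 2), σ ≠ τ → γᵀ (orb x σ) (orb y τ) = 0 :=
    fun x y σ τ hστ => by rw [Matrix.transpose_apply]; exact hblock y x τ σ (Ne.symm hστ)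
  have hPa : ∑ x : Λ, γᵀ (orb x 0) (orb x 0) = a := by simpa only [Matrix.transpose_apply] using ha
  have hPb : ∑ x : Λ, γᵀ (orb x 1) (orb x 1) = b := by simpa only [Matrix.transpose_apply] using hb
  have hmain := sectorGroundEnergy_le_re_groundStateFunctional hP hPP hPblock hPa hPb hH
  rwa [groundStateFunctional_molecularHamiltonian hP hPP, Matrix.transpose_transpose] at hmain

/-! ### Closed shells -/

/-- **The closed-shell one-matrix** built from a spatial one-matrix `ρ` on `Λ`:
`γ_{pσ,qτ} = δ_στ ρ_pq` (each spatial orbital of `ran ρ` doubly occupied; HJO (10.4.18):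
spin-summed density `D = 2ρ`). [cite: HelgakerJorgensenOlsen2000, eq. (10.4.18)] -/
def closedShellOneRDM (ρ : Matrix Λ Λ ℂ) : Matrix (Orb Λ) (Orb Λ) ℂ :=
  fun P Q => if (ofLex P).2 = (ofLex Q).2 then ρ (ofLex P).1 (ofLex Q).1 else 0

omit [LinearOrder Λ] [Fintype Λ] in
/-- Entries of the closed-shell one-matrix. [cite: HelgakerJorgensenOlsen2000, eq. (10.4.18)] -/
theorem closedShellOneRDM_orb (ρ : Matrix Λ Λ ℂ) (p q : Λ) (σ τ : Fin 2) :
    closedShellOneRDM ρ (orb p σ) (orb q τ) = if σ = τ then ρ p q else 0 := rfl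

omit [LinearOrder Λ] [Fintype Λ] in
/-- The closed-shell one-matrix of a Hermitian `ρ` is Hermitian.
[cite: HelgakerJorgensenOlsen2000, eq. (10.4.18)] -/
theorem closedShellOneRDM_isHermitian {ρ : Matrix Λ Λ ℂ} (hρ : ρ.IsHermitian) :
    (closedShellOneRDM ρ).IsHermitian := by
  refine Matrix.IsHermitian.ext fun P Q => ?_
  obtain ⟨⟨p, σ⟩, rfl⟩ := toLex.surjective P
  obtain ⟨⟨q, τ⟩, rfl⟩ := toLex.surjective Q
  change star (closedShellOneRDM ρ (orb q τ) (orb p σ)) = closedShellOneRDM ρ (orb p σ) (orb q τ)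
  rw [closedShellOneRDM_orb, closedShellOneRDM_orb]
  by_cases hστ : σ = τ
  · subst hστ
    rw [if_pos rfl, if_pos rfl]
    exact hρ.apply p q
  · rw [if_neg (Ne.symm hστ), if_neg hστ, star_zero]

omit [LinearOrder Λ] in
/-- The closed-shell one-matrix of a projection is a projection: `(ρ ⊗ 1)² = ρ² ⊗ 1`.
[cite: HelgakerJorgensenOlsen2000, eq. (10.4.18)] -/
theorem closedShellOneRDM_mul_self {ρ : Matrix Λ Λ ℂ} (hρρ : ρ * ρ = ρ) :
    closedShellOneRDM ρ * closedShellOneRDM ρ = closedShellOneRDM ρ := by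
  ext P Q
  obtain ⟨⟨p, σ⟩, rfl⟩ := toLex.surjective P
  obtain ⟨⟨q, τ⟩, rfl⟩ := toLex.surjective Q
  change (closedShellOneRDM ρ * closedShellOneRDM ρ) (orb p σ) (orb q τ) =
    closedShellOneRDM ρ (orb p σ) (orb q τ)
  rw [Matrix.mul_apply, sum_orb_eq_sum_sum_spin, closedShellOneRDM_orb]
  simp only [closedShellOneRDM_orb]
  by_cases hστ : σ = τ
  · subst hστ
    rw [if_pos rfl, show ρ p q = ∑ x, ρ p x * ρ x q by rw [← Matrix.mul_apply, hρρ]]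
    refine Finset.sum_congr rfl fun x _ => ?_
    rw [Finset.sum_eq_single σ (fun b _ hb => by rw [if_neg (Ne.symm hb), zero_mul])
      (fun hσ => absurd (Finset.mem_univ σ) hσ), if_pos rfl, if_pos rfl]
  · rw [if_neg hστ]
    refine Finset.sum_eq_zero fun x _ => Finset.sum_eq_zero fun b _ => ?_
    by_cases hb : σ = b
    · subst hb
      rw [if_neg hστ, mul_zero]
    · rw [if_neg hb, zero_mul]

omit [LinearOrder Λ] in
/-- `Tr (ρ ⊗ 1₂) = 2 Tr ρ`. [cite: HelgakerJorgensenOlsen2000, eq. (10.4.18)] -/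
theorem trace_closedShellOneRDM (ρ : Matrix Λ Λ ℂ) :
    (closedShellOneRDM ρ).trace = 2 * ρ.trace := by
  rw [Matrix.trace, Matrix.trace, Finset.mul_sum]
  change ∑ o, closedShellOneRDM ρ o o = _
  rw [sum_orb_eq_sum_sum_spin]
  refine Finset.sum_congr rfl fun x _ => ?_
  simp only [closedShellOneRDM_orb, if_true, Fin.sum_univ_two, Matrix.diag_apply]
  ring

omit [LinearOrder Λ] in
/-- **The closed-shell Hartree–Fock energy expression**: at `γ = ρ ⊗ 1₂`,
`E(γ, γ∧γ) = 2 Σ_pq h_pq ρ_pq + Σ_pqrs g_pqrs (2 ρ_pq ρ_rs − ρ_ps ρ_rq) + h_nuc` — HJO (10.4.15)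
with `D = 2ρ`, `d_pqrs = D_pq D_rs − ½ D_ps D_rq` ((10.4.18)–(10.4.19) in a general orbital basis).
[cite: HelgakerJorgensenOlsen2000, eqs. (10.4.15)-(10.4.19)] -/
theorem rdmEnergy_closedShell (h : Λ → Λ → ℂ) (g : Λ → Λ → Λ → Λ → ℂ) (hnuc : ℂ)
    (ρ : Matrix Λ Λ ℂ) :
    rdmEnergy h g hnuc (closedShellOneRDM ρ) (slaterTwoRDM (closedShellOneRDM ρ)) =
      2 * ∑ p : Λ, ∑ q : Λ, h p q * ρ p q +
        ∑ p : Λ, ∑ q : Λ, ∑ r : Λ, ∑ s : Λ, g p q r s * (2 * (ρ p q * ρ r s) - ρ p s * ρ r q) +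
        hnuc := by
  have h01 : (0 : Fin 2) ≠ 1 := by decide
  have h10 : (1 : Fin 2) ≠ 0 := by decide
  rw [rdmEnergy]
  congr 1
  congr 1
  · rw [Finset.mul_sum]
    refine Finset.sum_congr rfl fun p _ => ?_
    rw [Finset.mul_sum]
    refine Finset.sum_congr rfl fun q _ => ?_
    simp only [closedShellOneRDM_orb, if_true, Fin.sum_univ_two]
    ring
  · rw [Finset.mul_sum]
    refine Finset.sum_congr rfl fun p _ => ?_
    rw [Finset.mul_sum]
    refine Finset.sum_congr rfl fun q _ => ?_
    rw [Finset.mul_sum]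
    refine Finset.sum_congr rfl fun r _ => ?_
    rw [Finset.mul_sum]
    refine Finset.sum_congr rfl fun s _ => ?_
    simp only [slaterTwoRDM_apply, closedShellOneRDM_orb, if_true, Fin.sum_univ_two, if_neg h01,
      if_neg h10]
    ring

/-- **Closed-shell (RHF-type) upper bound.** For every Hermitian projection `ρ` of rank `n` on the
spatial orbital space and every integral table,
`E₀(Ĥ; 2n) ≤ Re [2 Σ_pq h_pq ρ_pq + Σ_pqrs g_pqrs (2 ρ_pq ρ_rs − ρ_ps ρ_rq) + h_nuc]`.
HJO §10.4.3 eqs. (10.4.14)–(10.4.19) with the variation principle; BLS94 (2c.36).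
[cite: HelgakerJorgensenOlsen2000, eqs. (10.4.14)-(10.4.19)] -/
theorem groundEnergy_le_re_closedShellEnergy (h : Λ → Λ → ℂ) (g : Λ → Λ → Λ → Λ → ℂ) (hnuc : ℂ)
    {ρ : Matrix Λ Λ ℂ} (hρ : ρ.IsHermitian) (hρρ : ρ * ρ = ρ) {n : ℕ} (htr : ρ.trace = n) :
    Literature.MathematicalPhysics.QuantumLattice.groundEnergy (molecularHamiltonian h g hnuc) (2 * n) ≤
      (2 * ∑ p : Λ, ∑ q : Λ, h p q * ρ p q +
        ∑ p : Λ, ∑ q : Λ, ∑ r : Λ, ∑ s : Λ, g p q r s * (2 * (ρ p q * ρ r s) - ρ p s * ρ r q) +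
        hnuc).re := by
  rw [← rdmEnergy_closedShell]
  refine groundEnergy_le_re_rdmEnergy_slaterTwoRDM h g hnuc (closedShellOneRDM_isHermitian hρ)
    (closedShellOneRDM_mul_self hρρ) ?_
  rw [trace_closedShellOneRDM, htr]
  push_cast
  ring

/-- **Closed-shell (RHF) bound on the `S_z = 0` SECTOR energy.** For Hermitian integral data and
every Hermitian projection `ρ` of rank `n` on the spatial orbitals, the `(N↑, N↓) = (n, n)` sector
energy obeys `E₀(Ĥ; n, n) ≤ Re [2 Σ_pq h_pq ρ_pq + Σ_pqrs g_pqrs (2 ρ_pq ρ_rs − ρ_ps ρ_rq) + h_nuc]`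
(the closed-shell determinant has `n` electrons of each spin). HJO §10.4.3 eqs. (10.4.14)–(10.4.19)
with the variation principle in the sector; BLS94 (2c.36). [cite: HelgakerJorgensenOlsen2000, eqs. (10.4.14)-(10.4.19)] -/
theorem sectorGroundEnergy_le_re_closedShellEnergy {h : Λ → Λ → ℂ} {g : Λ → Λ → Λ → Λ → ℂ}
    {hnuc : ℂ} (hH : (molecularHamiltonian h g hnuc).IsHermitian) {ρ : Matrix Λ Λ ℂ}
    (hρ : ρ.IsHermitian) (hρρ : ρ * ρ = ρ) {n : ℕ} (htr : ρ.trace = n) :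
    sectorGroundEnergy (molecularHamiltonian h g hnuc) n n ≤
      (2 * ∑ p : Λ, ∑ q : Λ, h p q * ρ p q +
        ∑ p : Λ, ∑ q : Λ, ∑ r : Λ, ∑ s : Λ, g p q r s * (2 * (ρ p q * ρ r s) - ρ p s * ρ r q) +
        hnuc).re := by
  rw [← rdmEnergy_closedShell]
  have hdiag : ∀ σ : Fin 2, ∑ x : Λ, closedShellOneRDM ρ (orb x σ) (orb x σ) = (n : ℂ) := by
    intro σ
    simp only [closedShellOneRDM_orb]
    rw [← htr, Matrix.trace]
    rfl
  exact sectorGroundEnergy_le_re_rdmEnergy_slaterTwoRDM hH (closedShellOneRDM_isHermitian hρ)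
    (closedShellOneRDM_mul_self hρρ)
    (fun x y σ τ hστ => by rw [closedShellOneRDM_orb, if_neg hστ]) (hdiag 0) (hdiag 1)

/-! ### Canonical orbitals: an occupied set -/

omit [Fintype Λ] in
/-- The indicator one-matrix of an occupied set of canonical orbitals is Hermitian. [folklore] -/
private theorem occDiagonal_isHermitian (occ : Finset Λ) :
    (Matrix.diagonal fun p : Λ => if p ∈ occ then (1 : ℂ) else 0).IsHermitian := by
  rw [Matrix.IsHermitian, Matrix.diagonal_conjTranspose]
  congr 1
  funext p
  simp only [Pi.star_apply]
  split_ifs <;> simp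

/-- … and idempotent. [folklore] -/
private theorem occDiagonal_mul_self (occ : Finset Λ) :
    (Matrix.diagonal fun p : Λ => if p ∈ occ then (1 : ℂ) else 0) *
        (Matrix.diagonal fun p : Λ => if p ∈ occ then (1 : ℂ) else 0) =
      Matrix.diagonal fun p : Λ => if p ∈ occ then (1 : ℂ) else 0 := by
  rw [Matrix.diagonal_mul_diagonal]
  congr 1
  funext p
  split_ifs <;> simp

/-- … with trace `|occ|`. [folklore] -/
private theorem trace_occDiagonal (occ : Finset Λ) :
    (Matrix.diagonal fun p : Λ => if p ∈ occ then (1 : ℂ) else 0).trace = (occ.card : ℕ) := by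
  rw [Matrix.trace_diagonal]
  simp only [Finset.sum_boole, Finset.filter_mem_eq_inter, Finset.univ_inter]

/-- The closed-shell energy expression at the indicator of `occ` is HJO's canonical formula
(10.4.20) `2 Σ_{i∈occ} h_ii + Σ_{i,j∈occ} (2 g_iijj − g_ijji) + h_nuc`.
[cite: HelgakerJorgensenOlsen2000, eq. (10.4.20)] -/
private theorem closedShellEnergy_occDiagonal (h : Λ → Λ → ℂ) (g : Λ → Λ → Λ → Λ → ℂ) (hnuc : ℂ)
    (occ : Finset Λ) :
    2 * ∑ p : Λ, ∑ q : Λ, h p q * (Matrix.diagonal fun p : Λ => if p ∈ occ then (1 : ℂ) else 0) p q +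
        ∑ p : Λ, ∑ q : Λ, ∑ r : Λ, ∑ s : Λ, g p q r s *
          (2 * ((Matrix.diagonal fun p : Λ => if p ∈ occ then (1 : ℂ) else 0) p q *
              (Matrix.diagonal fun p : Λ => if p ∈ occ then (1 : ℂ) else 0) r s) -
            (Matrix.diagonal fun p : Λ => if p ∈ occ then (1 : ℂ) else 0) p s *
              (Matrix.diagonal fun p : Λ => if p ∈ occ then (1 : ℂ) else 0) r q) +
        hnuc =
      2 * ∑ i ∈ occ, h i i + ∑ i ∈ occ, ∑ j ∈ occ, (2 * g i i j j - g i j j i) + hnuc := by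
  set d : Λ → ℂ := fun p => if p ∈ occ then 1 else 0 with hd
  have h1 : ∑ p : Λ, ∑ q : Λ, h p q * Matrix.diagonal d p q = ∑ i ∈ occ, h i i := by
    have hq : ∀ p : Λ, ∑ q : Λ, h p q * Matrix.diagonal d p q = h p p * d p := fun p => by
      rw [Finset.sum_eq_single p (fun q _ hq => by
        rw [Matrix.diagonal_apply_ne _ (Ne.symm hq), mul_zero]) (fun hp => absurd (mem_univ p) hp),
        Matrix.diagonal_apply_eq]
    simp only [hq]
    simp only [hd, mul_ite, mul_one, mul_zero]
    rw [Finset.sum_ite_mem, Finset.univ_inter]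
  have hA : ∀ p : Λ, ∑ q : Λ, ∑ r : Λ, ∑ s : Λ,
      g p q r s * (2 * (Matrix.diagonal d p q * Matrix.diagonal d r s)) =
        ∑ r : Λ, 2 * g p p r r * (d p * d r) := by
    intro p
    rw [Finset.sum_eq_single p (fun q _ hq => by
      simp [Matrix.diagonal_apply_ne _ (Ne.symm hq)]) (fun hp => absurd (mem_univ p) hp),
      Matrix.diagonal_apply_eq]
    refine Finset.sum_congr rfl fun r _ => ?_
    rw [Finset.sum_eq_single r (fun s _ hs => by
      simp [Matrix.diagonal_apply_ne _ (Ne.symm hs)]) (fun hr => absurd (mem_univ r) hr),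
      Matrix.diagonal_apply_eq]
    ring
  have hB : ∀ p : Λ, ∑ q : Λ, ∑ r : Λ, ∑ s : Λ,
      g p q r s * (Matrix.diagonal d p s * Matrix.diagonal d r q) =
        ∑ r : Λ, g p r r p * (d p * d r) := by
    intro p
    have hs : ∀ q r : Λ, ∑ s : Λ, g p q r s * (Matrix.diagonal d p s * Matrix.diagonal d r q) =
        g p q r p * (d p * Matrix.diagonal d r q) := fun q r => by
      rw [Finset.sum_eq_single p (fun s _ hs => by
        simp [Matrix.diagonal_apply_ne _ (Ne.symm hs)]) (fun hp => absurd (mem_univ p) hp),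
        Matrix.diagonal_apply_eq]
    simp only [hs]
    rw [Finset.sum_comm]
    refine Finset.sum_congr rfl fun r _ => ?_
    rw [Finset.sum_eq_single r (fun q _ hq => by
      simp [Matrix.diagonal_apply_ne _ (Ne.symm hq)]) (fun hr => absurd (mem_univ r) hr),
      Matrix.diagonal_apply_eq]
  have h2 : ∑ p : Λ, ∑ q : Λ, ∑ r : Λ, ∑ s : Λ, g p q r s *
      (2 * (Matrix.diagonal d p q * Matrix.diagonal d r s) -
        Matrix.diagonal d p s * Matrix.diagonal d r q) =
      ∑ i ∈ occ, ∑ j ∈ occ, (2 * g i i j j - g i j j i) := by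
    have hC : ∀ p : Λ, ∑ q : Λ, ∑ r : Λ, ∑ s : Λ, g p q r s *
        (2 * (Matrix.diagonal d p q * Matrix.diagonal d r s) -
          Matrix.diagonal d p s * Matrix.diagonal d r q) =
        ∑ r : Λ, (2 * g p p r r - g p r r p) * (d p * d r) := by
      intro p
      simp only [mul_sub, Finset.sum_sub_distrib, hA, hB]
      rw [← Finset.sum_sub_distrib]
      exact Finset.sum_congr rfl fun r _ => by ring
    simp only [hC]
    rw [← Finset.sum_subset (Finset.subset_univ occ) (fun p _ hp => by
      simp only [hd, if_neg hp, zero_mul, mul_zero, Finset.sum_const_zero])]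
    refine Finset.sum_congr rfl fun i hi => ?_
    rw [← Finset.sum_subset (Finset.subset_univ occ) (fun r _ hr => by
      simp only [hd, if_neg hr, mul_zero])]
    refine Finset.sum_congr rfl fun j hj => ?_
    simp only [hd, if_pos hi, if_pos hj, mul_one]
  rw [h1, h2]

/-- **The canonical Hartree–Fock energy bounds the full-CI energy from above**: for any set `occ`
of (canonical, orthonormal) spatial orbitals of the basis, doubly occupied,
`E₀(Ĥ; 2|occ|) ≤ Re [2 Σ_{i∈occ} h_ii + Σ_{i,j∈occ} (2 g_iijj − g_ijji) + h_nuc]` — HJO eq. (10.4.20)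
`E⁽⁰⁾ = 2 Σ_i h_ii + Σ_ij (2 g_iijj − g_ijji) + h_nuc` as an inequality against the exact energy of
the `2|occ|`-electron sector (the variation principle, §4.2.1). [cite: HelgakerJorgensenOlsen2000, eq. (10.4.20)] -/
theorem groundEnergy_le_re_occupiedShellEnergy (h : Λ → Λ → ℂ) (g : Λ → Λ → Λ → Λ → ℂ)
    (hnuc : ℂ) (occ : Finset Λ) :
    Literature.MathematicalPhysics.QuantumLattice.groundEnergy (molecularHamiltonian h g hnuc)
        (2 * occ.card) ≤
      (2 * ∑ i ∈ occ, h i i + ∑ i ∈ occ, ∑ j ∈ occ, (2 * g i i j j - g i j j i) + hnuc).re := by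
  rw [← closedShellEnergy_occDiagonal]
  exact groundEnergy_le_re_closedShellEnergy h g hnuc (occDiagonal_isHermitian occ)
    (occDiagonal_mul_self occ) (trace_occDiagonal occ)

/-- **The canonical closed-shell Hartree–Fock energy bounds the SECTOR energy**: for Hermitian
integral data and any occupied set `occ` of canonical spatial orbitals,
`E₀(Ĥ; |occ|, |occ|) ≤ Re [2 Σ_{i∈occ} h_ii + Σ_{i,j∈occ} (2 g_iijj − g_ijji) + h_nuc]` — HJO
eq. (10.4.20) against the exact energy of the `(N↑, N↓) = (|occ|, |occ|)` sector (e.g. the RHF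
energy of an FCIDUMP in canonical orbitals, `occ` = the `N/2` lowest). [cite: HelgakerJorgensenOlsen2000, eq. (10.4.20)] -/
theorem sectorGroundEnergy_le_re_occupiedShellEnergy {h : Λ → Λ → ℂ} {g : Λ → Λ → Λ → Λ → ℂ}
    {hnuc : ℂ} (hH : (molecularHamiltonian h g hnuc).IsHermitian) (occ : Finset Λ) :
    sectorGroundEnergy (molecularHamiltonian h g hnuc) occ.card occ.card ≤
      (2 * ∑ i ∈ occ, h i i + ∑ i ∈ occ, ∑ j ∈ occ, (2 * g i i j j - g i j j i) + hnuc).re := by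
  rw [← closedShellEnergy_occDiagonal]
  exact sectorGroundEnergy_le_re_closedShellEnergy hH (occDiagonal_isHermitian occ)
    (occDiagonal_mul_self occ) (trace_occDiagonal occ)

end Molecular

end Literature.MathematicalPhysics.QuantumChemistry
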